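import Summits.CriticalPhenomena.PercolationContinuityZ3.Theorems.PercNearOneGluingNoHeavyLowerTailFrontierDecRowsKeyCellMono
import Summits.CriticalPhenomena.PercolationContinuityZ3.Theorems.PercNearOneGluingNoHeavyLowerTailFrontierDecRowsKeyCellRows
import Summits.CriticalPhenomena.PercolationContinuityZ3.Theorems.PercNearOneGluingAdditiveGluingOneBond
import HarnessLib

/-!
# Events by truth table, agreement by decision, and glued (weight-one pair) rows in the 52 cells

Support file (prover seat `prim-facecert`, gen 5; `--supports stmt-CriticalPhenomena-4575`).  No named facts, no sorries, no `native_decide`;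
bookkeeping definitions `patCodeOf`, `maskPat`, `agreeCheck` only.  Sequel of `…KeyCellDict` / `…KeyCellRows` / `…KeyCellMono`.
* `maskPat S` — the pattern predicate "the connectivity code is in the list `S`" (how a certificate generator names an event: by its cells);
* `agreeCheck Φ Ψ` (decide) ⇒ `pev Φ v = pev Ψ v` (`pev_eq_of_agreeCheck`): identifies a truth-table event with the structural event of a tree theorem;
* `real_insert_pev` — GLUING a pair of the five points: `P_{w[s(v t, v u) ↦ 1]}(pev Φ v) = P_w(pev (liftPat t u Φ) v)` for EVERY `w`
  (`goodStepEI_prodBernoulli_map_insert`); rows of a quotient graph (AG / T_inc / 3PT rows on glued groups, prim-facecert dict5 'groups as lifts') are rows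
  of lifted predicates in the same cells.
-/

noncomputable section

namespace Summit.CriticalPhenomena.PercolationContinuityZ3.Theorems

namespace TerminalEdgeInduction

open MeasureTheory Literature.Probability.Percolation Literature.Probability.LatticeModels
open EdgeInduction CovTransferCert E3GroupSepCert PatternCells FaceCertKernelN
open scoped Classical

variable {n : ℕ}

/-- The 10-bit connectivity code of a `5 × 5` Boolean matrix (pair bits as in `PatternCells`). [this work] -/
def patCodeOf (M : Fin 5 → Fin 5 → Bool) : ℕ :=
  ((List.finRange 10).map fun p : Fin 10 => if M (pairFst p) (pairSnd p) then 2 ^ p.val else 0).sum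

/-- **Event by truth table**: the pattern predicate "the connectivity code lies in `S`". [this work] -/
def maskPat (S : List ℕ) : (Fin 5 → Fin 5 → Bool) → Bool := fun M => decide (patCodeOf M ∈ S)

/-- Two pattern predicates agree on the 52 consistent patterns. [this work] -/
def agreeCheck (Φ Ψ : (Fin 5 → Fin 5 → Bool) → Bool) : Bool :=
  cellCodeList.all fun m => Φ (mrel m) == Ψ (mrel m)

/-- **Agreement by decision**: predicates that agree on the consistent patterns define the same event. [this work] -/
theorem pev_eq_of_agreeCheck {Φ Ψ : (Fin 5 → Fin 5 → Bool) → Bool} (h : agreeCheck Φ Ψ = true) (v : Fin 5 → Fin n) :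
    pev Φ v = pev Ψ v := by
  ext ω
  obtain ⟨m, hm, hcell⟩ := exists_mem_cell v ω
  rw [mem_pev_iff_of_mem_cell Φ v hcell, mem_pev_iff_of_mem_cell Ψ v hcell]
  simp only [agreeCheck, List.all_eq_true, beq_iff_eq] at h
  rw [h m (mem_cellCodeList_of_mem_cell v hm hcell)]

/-- **Gluing a pair of marked points** (weight-one pair = pull-back along `insert`): for every weight `w`,
`P_{w[s(v t, v u) ↦ 1]}(pev Φ v) = P_w(pev (liftPat t u Φ) v)`. [this work] -/
theorem real_insert_pev (w : Sym2 (Fin n) → unitInterval) (v : Fin 5 → Fin n) (t u : Fin 5) (Φ : (Fin 5 → Fin 5 → Bool) → Bool) :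
    (prodBernoulli (Function.update w s(v t, v u) 1)).real (pev Φ v) = (prodBernoulli w).real (pev (liftPat t u Φ) v) := by
  have hmi : Measurable fun ω : BondConfig (Fin n) => insert s(v t, v u) ω := fun s _ => (Set.toFinite _).measurableSet
  have hset : (fun ω : BondConfig (Fin n) => insert s(v t, v u) ω) ⁻¹' (pev Φ v) = pev (liftPat t u Φ) v := by
    rw [← pev_liftPat, pev_def]
    ext ω
    rw [Set.mem_preimage]
    exact insert_mem_connEvent_iff (v t) (v u) _ ω
  rw [← goodStepEI_prodBernoulli_map_insert w s(v t, v u), measureReal_def, measureReal_def,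
    Measure.map_apply hmi (Set.toFinite _).measurableSet, hset]

/-- Example / test: the truth table of `D[a|b]` agrees with `sepPat [0] [1]`. [this work] -/
example : agreeCheck (maskPat [298, 266, 910, 198, 134, 66, 610, 34, 514, 2, 184, 24, 40, 136, 8, 540, 524, 340, 20, 68, 260, 4, 336, 1008, 176, 528,
    16, 192, 64, 608, 288, 32, 256, 896, 128, 512, 0]) (sepPat [0] [1]) = true := by
  decide

end TerminalEdgeInduction

end Summit.CriticalPhenomena.PercolationContinuityZ3.Theorems
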